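import Mathlib
import HarnessLib

/-!
# The one-shift window system, IX: BANDED bookkeeping — weighted row-mass bounds for a matrix carried as
# (kept entries) + (per-row dropped mass), their propagation through a product, re-dropping, and the
# charges to a box hull and to a preconditioned row sum (cell harvest/h2-tao-ladder, seat p2;
# rung1/RUNG1-P2G11-REPORT.md §49/§51 and rung1/KERNEL-CHEAP-REPLAY-SPEC.md §2 (g), §3 S3;
# support for K1(1) = `NoSurvivingDSSOne`, stmt-NavierStokesRegularity-20205)

MODEL-lattice certificate infrastructure only; elementary finite sums over `ℝ`; nothing here is a statement
about the Navier–Stokes equations; no item is closed; nothing numerical is proved.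

The frameless replay (REPORT §49) carries the variational enclosure `V` as a matrix `W` of KEPT entries plus a
per-row bound `Rm i ≥ Σ_j |V i j − W i j| σ j` on the σ-weighted mass of everything dropped
(`RowMassLE`). This file proves the four rules the replay's Boolean uses (SPEC §2 (g)):
* `abs_mulVec_sub_le_of_rowMassLE` — HULL CHARGE: for `|x j| ≤ ρ σ j`, `|(V x) i − (W x) i| ≤ Rm i · ρ`;
* `rowMassLE_mul` — PRODUCT: if moreover `|A i k − Ab i k| ≤ Δ i k` and `M k ≥ Σ_j |V k j| σ j`, then
  `A·V` versus `Ab·W` has row mass `≤ Σ_k |Ab i k| Rm k + Σ_k Δ i k M k`;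
* `rowMassLE_of_drop` — RE-DROP: zeroing a set of kept entries moves their weighted mass into `Rm`;
* `mass_le_of_rowMassLE` — the true weighted mass is at most the kept mass plus `Rm` (the `M k` the product
  rule consumes).
-/

noncomputable section

-- the sub-problem namespace repeats the summit name by design (D-0017)
set_option linter.dupNamespace false

namespace Summit.NavierStokesRegularity.NavierStokesRegularity.Theorems

namespace DSSOneShift

namespace BandedMass

open Finset Matrix

variable {ι : Type*} [Fintype ι]

/-- `W` represents `V` up to σ-weighted row mass `Rm`: `Σ_j |V i j − W i j| σ j ≤ Rm i` for every row (a weighted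
ℓ¹ enclosure of the rows of `V − W`; the bookkeeping predicate of a banded interval matrix product). [folklore; cite: cell vocabulary, harvest/h2-tao-ladder rung1/KERNEL-CHEAP-REPLAY-SPEC.md §2 (g)] -/
def RowMassLE (σ : ι → ℝ) (V W : Matrix ι ι ℝ) (Rm : ι → ℝ) : Prop :=
  ∀ i, (∑ j, |V i j - W i j| * σ j) ≤ Rm i

/-- The exact representative has zero dropped mass. [folklore] -/
theorem rowMassLE_self (σ : ι → ℝ) (V : Matrix ι ι ℝ) : RowMassLE σ V V 0 := by
  intro i; simp

/-- **HULL CHARGE.** If `|x j| ≤ ρ σ j` then `|(V x) i − (W x) i| ≤ Rm i · ρ`. [folklore; cite: cell vocabulary, harvest/h2-tao-ladder rung1/KERNEL-CHEAP-REPLAY-SPEC.md §2 (g)] -/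
theorem abs_mulVec_sub_le_of_rowMassLE {σ : ι → ℝ} {V W : Matrix ι ι ℝ} {Rm : ι → ℝ}
    (h : RowMassLE σ V W Rm) {x : ι → ℝ} {ρ : ℝ} (hρ : 0 ≤ ρ) (hx : ∀ j, |x j| ≤ ρ * σ j) (i : ι) :
    |(V *ᵥ x) i - (W *ᵥ x) i| ≤ Rm i * ρ := by
  have hσx : ∀ j, |x j| ≤ σ j * ρ := fun j => by rw [mul_comm]; exact hx j
  calc |(V *ᵥ x) i - (W *ᵥ x) i| = |∑ j, (V i j - W i j) * x j| := by
        simp only [mulVec, dotProduct, ← Finset.sum_sub_distrib, sub_mul]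
    _ ≤ ∑ j, |(V i j - W i j) * x j| := abs_sum_le_sum_abs _ _
    _ = ∑ j, |V i j - W i j| * |x j| := by simp only [abs_mul]
    _ ≤ ∑ j, |V i j - W i j| * (σ j * ρ) := by
        gcongr with j _
        exact hσx j
    _ = (∑ j, |V i j - W i j| * σ j) * ρ := by
        rw [Finset.sum_mul]; refine Finset.sum_congr rfl fun j _ => by ring
    _ ≤ Rm i * ρ := mul_le_mul_of_nonneg_right (h i) hρ

/-- **TOTAL MASS.** The σ-weighted mass of the true row is at most the kept mass plus the dropped bound.
[folklore] -/
theorem mass_le_of_rowMassLE {σ : ι → ℝ} {V W : Matrix ι ι ℝ} {Rm : ι → ℝ} (hσ : ∀ j, 0 ≤ σ j)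
    (h : RowMassLE σ V W Rm) (k : ι) :
    (∑ j, |V k j| * σ j) ≤ (∑ j, |W k j| * σ j) + Rm k := by
  have h1 : ∀ j, |V k j| * σ j ≤ |W k j| * σ j + |V k j - W k j| * σ j := fun j => by
    rw [← add_mul]
    exact mul_le_mul_of_nonneg_right (by
      calc |V k j| = |W k j + (V k j - W k j)| := by ring_nf
        _ ≤ |W k j| + |V k j - W k j| := abs_add_le _ _) (hσ j)
  calc (∑ j, |V k j| * σ j) ≤ ∑ j, (|W k j| * σ j + |V k j - W k j| * σ j) := Finset.sum_le_sum fun j _ => h1 j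
    _ = (∑ j, |W k j| * σ j) + ∑ j, |V k j - W k j| * σ j := Finset.sum_add_distrib
    _ ≤ (∑ j, |W k j| * σ j) + Rm k := by gcongr; exact h k

/-- **PRODUCT RULE.** Kept-times-kept represents true-times-true with row mass
`Σ_k |Ab i k| Rm k + Σ_k Δ i k M k`, where `Δ` bounds the dropped/enclosure defect of `A` and `M k` the true
weighted mass of row `k` of `V`. [folklore; cite: cell vocabulary, harvest/h2-tao-ladder rung1/KERNEL-CHEAP-REPLAY-SPEC.md §2 (g)] -/
theorem rowMassLE_mul {σ : ι → ℝ} {V W A Ab : Matrix ι ι ℝ} {Rm M Rm' : ι → ℝ} {Δ : Matrix ι ι ℝ}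
    (hσ : ∀ j, 0 ≤ σ j) (hV : RowMassLE σ V W Rm) (hA : ∀ i k, |A i k - Ab i k| ≤ Δ i k)
    (hM : ∀ k, (∑ j, |V k j| * σ j) ≤ M k)
    (hRm' : ∀ i, (∑ k, |Ab i k| * Rm k) + (∑ k, Δ i k * M k) ≤ Rm' i) :
    RowMassLE σ (A * V) (Ab * W) Rm' := by
  intro i
  -- (A V − Ab W) i j = Σ_k Ab i k (V k j − W k j) + Σ_k (A i k − Ab i k) V k j
  have hsplit : ∀ j, (A * V) i j - (Ab * W) i j =
      (∑ k, Ab i k * (V k j - W k j)) + ∑ k, (A i k - Ab i k) * V k j := by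
    intro j
    simp only [Matrix.mul_apply, ← Finset.sum_sub_distrib, ← Finset.sum_add_distrib]
    exact Finset.sum_congr rfl fun k _ => by ring
  have hRm0 : ∀ k, 0 ≤ Rm k := fun k =>
    le_trans (Finset.sum_nonneg fun j _ => mul_nonneg (abs_nonneg _) (hσ j)) (hV k)
  calc (∑ j, |(A * V) i j - (Ab * W) i j| * σ j)
      ≤ ∑ j, ((∑ k, |Ab i k| * |V k j - W k j|) + ∑ k, |A i k - Ab i k| * |V k j|) * σ j := by
        refine Finset.sum_le_sum fun j _ => mul_le_mul_of_nonneg_right ?_ (hσ j)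
        rw [hsplit j]
        refine (abs_add_le _ _).trans (add_le_add ?_ ?_)
        · exact (abs_sum_le_sum_abs _ _).trans (le_of_eq (Finset.sum_congr rfl fun k _ => abs_mul _ _))
        · exact (abs_sum_le_sum_abs _ _).trans (le_of_eq (Finset.sum_congr rfl fun k _ => abs_mul _ _))
    _ = (∑ k, |Ab i k| * ∑ j, |V k j - W k j| * σ j) + ∑ k, |A i k - Ab i k| * ∑ j, |V k j| * σ j := by
        simp only [add_mul, Finset.sum_add_distrib, Finset.sum_mul, Finset.mul_sum]
        congr 1
        · rw [Finset.sum_comm]; exact Finset.sum_congr rfl fun k _ => Finset.sum_congr rfl fun j _ => by ring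
        · rw [Finset.sum_comm]; exact Finset.sum_congr rfl fun k _ => Finset.sum_congr rfl fun j _ => by ring
    _ ≤ (∑ k, |Ab i k| * Rm k) + ∑ k, Δ i k * M k := by
        refine add_le_add (Finset.sum_le_sum fun k _ => mul_le_mul_of_nonneg_left (hV k) (abs_nonneg _))
          (Finset.sum_le_sum fun k _ => ?_)
        have hMk : 0 ≤ M k := le_trans (Finset.sum_nonneg fun j _ => mul_nonneg (abs_nonneg _) (hσ j)) (hM k)
        exact mul_le_mul (hA i k) (hM k) (Finset.sum_nonneg fun j _ => mul_nonneg (abs_nonneg _) (hσ j))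
          ((abs_nonneg _).trans (hA i k))
    _ ≤ Rm' i := hRm' i

/-- **RE-DROP RULE.** Zeroing the kept entries in a set `Z i` of columns moves their weighted mass into the
bound. [folklore; cite: cell vocabulary, harvest/h2-tao-ladder rung1/KERNEL-CHEAP-REPLAY-SPEC.md §2 (g)] -/
theorem rowMassLE_of_drop [DecidableEq ι] {σ : ι → ℝ} {V W : Matrix ι ι ℝ} {Rm Rm' : ι → ℝ} (hσ : ∀ j, 0 ≤ σ j)
    (hV : RowMassLE σ V W Rm) (Z : ι → Finset ι)
    (hRm' : ∀ i, Rm i + (∑ j ∈ Z i, |W i j| * σ j) ≤ Rm' i) :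
    RowMassLE σ V (fun i j => if j ∈ Z i then 0 else W i j) Rm' := by
  intro i
  have hpt : ∀ j, |V i j - (if j ∈ Z i then 0 else W i j)| * σ j ≤
      |V i j - W i j| * σ j + (if j ∈ Z i then |W i j| * σ j else 0) := by
    intro j
    by_cases hj : j ∈ Z i
    · simp only [hj, if_true, sub_zero]
      rw [← add_mul]
      exact mul_le_mul_of_nonneg_right (by
        calc |V i j| = |(V i j - W i j) + W i j| := by ring_nf
          _ ≤ |V i j - W i j| + |W i j| := abs_add_le _ _) (hσ j)
    · simp [hj]
  calc (∑ j, |V i j - (if j ∈ Z i then 0 else W i j)| * σ j)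
      ≤ ∑ j, (|V i j - W i j| * σ j + (if j ∈ Z i then |W i j| * σ j else 0)) := Finset.sum_le_sum fun j _ => hpt j
    _ = (∑ j, |V i j - W i j| * σ j) + ∑ j ∈ Z i, |W i j| * σ j := by
        rw [Finset.sum_add_distrib, Finset.sum_ite_mem, Finset.univ_inter]
    _ ≤ Rm i + ∑ j ∈ Z i, |W i j| * σ j := by gcongr; exact hV i
    _ ≤ Rm' i := hRm' i

/-- **ROW CHARGE for a preconditioned row sum** (the Krawczyk charge of SPEC §2: the dropped part of a scaled
Jacobian row `k`, `Σ_j |c| |V k j − W k j| σ j ρ / s`, is at most `|c| Rm k ρ / s`). [folklore; cite: cell vocabulary, harvest/h2-tao-ladder rung1/KERNEL-CHEAP-REPLAY-SPEC.md §2 (Krawczyk file)] -/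
theorem krawczyk_charge_le {σ : ι → ℝ} {V W : Matrix ι ι ℝ} {Rm : ι → ℝ} (hσ : ∀ j, 0 ≤ σ j)
    (h : RowMassLE σ V W Rm) (k : ι) {c ρ s : ℝ} (hρ : 0 ≤ ρ) (hs : 0 < s) :
    (∑ j, |c * (V k j - W k j) * σ j / s| * ρ) ≤ |c| * Rm k * ρ / s := by
  have hσ' : ∀ j, |c * (V k j - W k j) * σ j / s| = |c| * (|V k j - W k j| * σ j) / s := fun j => by
    rw [abs_div, abs_mul, abs_mul, abs_of_pos hs, abs_of_nonneg (hσ j)]; ring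
  have key : (∑ j, |c * (V k j - W k j) * σ j / s| * ρ) = |c| * ρ / s * ∑ j, |V k j - W k j| * σ j := by
    rw [Finset.mul_sum]; exact Finset.sum_congr rfl fun j _ => by rw [hσ' j]; ring
  rw [key]
  calc |c| * ρ / s * ∑ j, |V k j - W k j| * σ j ≤ |c| * ρ / s * Rm k :=
        mul_le_mul_of_nonneg_left (h k) (by positivity)
    _ = |c| * Rm k * ρ / s := by ring

end BandedMass

end DSSOneShift

end Summit.NavierStokesRegularity.NavierStokesRegularity.Theorems
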